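import Summits.AtomisticToContinuum.HydrodynamicLimit.Theorems.TransferActivityTails.Negative.ExpMomentLattice
import Summits.AtomisticToContinuum.HydrodynamicLimit.Theorems.EquilibriumClampedCollisionalWindowLD.Negative.FinalIneq2

/-!
# Negative knowledge for the crux `TwoClocks.TransferActivityTails` (stmt-AtomisticToContinuum-16624):
# the EXPONENTIAL-MOMENT (large-deviation) strengthening of its equilibrium rung is FALSE — part 2,
# the Gibbs lower bound on the labelled events, the concrete lattice and the refutation

Continuation of `ExpMomentLattice.lean` (statement `TransferActivityTailsExpMoment`, pointwise bounds); see its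
header for the mechanism.  From the standing disprover's workfile `Cruxes/TransferActivityTails/Disproof.lean` §5
(refuter-cdisprove-stmt-AtomisticToContinuum-16624-0, cycle 1).  Nothing here asserts a Theses declaration.

* `lintegral_tail_ge` — the 13733 `lintegral_ge` with the integrand exchanged:
  `(N+1)! · e^{Fmin N kw β 1} · evB ≤ ∫ exp(B Σₚ aₚ𝟙{aₚ>V}) dG_N` (restriction to the disjoint labelled events,
  pointwise bound `exponent_ge_tail` off the null set `goodᶜ`, uniform event weight `measure_Ev_ge`, `(N+1)!`
  labellings);
* `gRec_ge`, `ε_eq_κw` — on the witness lattice `LatW l n t`: energy floor `≥ (9/80) t⁶`, scale identity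
  `ε = (σ/τ)·w`;
* `transferActivityTailsExpMoment_false` — the refutation (`β = 2`, `ε = 1`, `τ = t⁴`, `σ = (4/5)/l²`,
  `N + 1 = (l n)³`; the 13733 `final_ineq` at `β = 1`, `Z = 1`).
-/

noncomputable section

open Real MeasureTheory
open scoped InnerProductSpace

namespace Summit.AtomisticToContinuum.HydrodynamicLimit.Theorems

namespace TransferActivityTailsNegative

open Literature.Analysis.FluidPDE Literature.Analysis.FunctionSpaces Literature.MathematicalPhysics.KineticTheory
open EquilibriumClampedCollisionalWindowLDNegative EquilibriumClampedCollisionalWindowLDNegative.Lat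

section Lattice

variable {Λ : EquilibriumClampedCollisionalWindowLDNegative.Lat} {N : ℕ} {a : Fin (N + 1) ≃ Λ.Slot}
variable {Φ : HardSphereFlow (Torus.geometry (Fin 3)) Λ.P.ε (N + 1)}

/-- **The main lower bound for the exponential moment of the tail sum** (the 13733 `lintegral_ge` with the
integrand exchanged): `(N+1)! · e^{Fmin N kw β 1} · evB ≤ ∫ exp(B Σₚ aₚ𝟙{aₚ>V}) dG_N`. -/
theorem lintegral_tail_ge (hcardN : Fintype.card Λ.Slot = N + 1) (hW : Λ.WinOK) (hG : Λ.GainOK)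
    (hε : Λ.P.ε < 1 / 2) (hr : Λ.P.r < 1 / 2) (hw0 : 0 < Λ.w) {σ : ℝ} (hσ : σ ≤ 1 / 2)
    (hεσ : hsDiameter σ N = Λ.P.ε)
    (hgoodP : localGibbsMeasure σ (fun _ => 1) (fun _ => 0) (fun _ => (1 : ℝ)) N Φ.goodᶜ = 0)
    {κ V β B : ℝ} (hκ : 0 ≤ κ) (hV : V < κ * gRec Λ.P) (hβ : 0 ≤ β) (hB : 2 * β ≤ B) (hκε : Λ.P.ε ≤ κ * Λ.w)
    {kw : ℕ} (hkK : kw + 1 ≤ Λ.P.K) (hkw : (kw : ℝ) * Λ.P.θhi ≤ Λ.w) (hM : 24 * Λ.m ≤ Λ.M) :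
    ENNReal.ofReal (((N + 1).factorial : ℝ) * Real.exp (Λ.Fmin N kw β 1) * Λ.evB N) ≤
      ∫⁻ z, ENNReal.ofReal (Real.exp (B * ∑ p : Fin (N + 1),
          Set.indicator {y : ℝ | V < y} (fun y => y) (actT Λ Φ κ p z)))
        ∂(localGibbsMeasure σ (fun _ => 1) (fun _ => 0) (fun _ => (1 : ℝ)) N) := by
  classical
  set P := localGibbsMeasure σ (fun _ => 1) (fun _ => 0) (fun _ => (1 : ℝ)) N with hP
  set f : Cfg N → ENNReal := fun z => ENNReal.ofReal (Real.exp (B * ∑ p : Fin (N + 1),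
      Set.indicator {y : ℝ | V < y} (fun y => y) (actT Λ Φ κ p z)))
  set c : ENNReal := ENNReal.ofReal (Real.exp (Λ.Fmin N kw β 1)) with hc
  -- Step 1: restrict to the disjoint union of the labelled events
  have hmeas : ∀ a : Fin (N + 1) ≃ Λ.Slot, MeasurableSet (Λ.Ev a : Set (Cfg N)) := fun a => measurableSet_Ev
  have hdisj : Pairwise (Function.onFun Disjoint fun a : Fin (N + 1) ≃ Λ.Slot => (Λ.Ev a : Set (Cfg N))) :=
    fun a a' h => Ev_disjoint hW h
  have step1 : ∑ a : Fin (N + 1) ≃ Λ.Slot, ∫⁻ z in Λ.Ev a, f z ∂P ≤ ∫⁻ z, f z ∂P := by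
    have h := lintegral_iUnion (μ := P) hmeas hdisj f
    rw [tsum_fintype] at h
    rw [← h]
    exact setLIntegral_le_lintegral _ _
  -- Step 2: on each event the integrand is at least `c` off the null set `goodᶜ`
  have step2 : ∀ a : Fin (N + 1) ≃ Λ.Slot, c * P (Λ.Ev a) ≤ ∫⁻ z in Λ.Ev a, f z ∂P := by
    intro a
    have hpt : ∀ z ∈ Λ.Ev a, (Φ.good).indicator (fun _ => c) z ≤ f z := by
      intro z hz
      by_cases hg : z ∈ Φ.good
      · rw [Set.indicator_of_mem hg]
        exact ENNReal.ofReal_le_ofReal (Real.exp_le_exp.2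
          (exponent_ge_tail hW hG hε hw0 hz hg hκ hV hβ hB hκε hkK hkw hM))
      · rw [Set.indicator_of_notMem hg]; exact bot_le
    calc c * P (Λ.Ev a) ≤ c * P (Φ.good ∩ Λ.Ev a) := by
          refine mul_le_mul' le_rfl ?_
          have hsub : (Λ.Ev a : Set (Cfg N)) ⊆ (Φ.good ∩ Λ.Ev a) ∪ Φ.goodᶜ := by
            intro z hz; by_cases hg : z ∈ Φ.good
            · exact Or.inl ⟨hg, hz⟩
            · exact Or.inr hg
          calc P (Λ.Ev a) ≤ P ((Φ.good ∩ Λ.Ev a) ∪ Φ.goodᶜ) := measure_mono hsub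
            _ ≤ P (Φ.good ∩ Λ.Ev a) + P Φ.goodᶜ := measure_union_le _ _
            _ = P (Φ.good ∩ Λ.Ev a) := by rw [hgoodP, add_zero]
      _ = ∫⁻ z in Λ.Ev a, (Φ.good).indicator (fun _ => c) z ∂P := by
          rw [lintegral_indicator_const Φ.measurableSet_good, Measure.restrict_apply Φ.measurableSet_good]
      _ ≤ ∫⁻ z in Λ.Ev a, f z ∂P := setLIntegral_mono' (hmeas a) hpt
  -- Step 3: the uniform measure bound and the count of labellings
  have step3 : ∀ a : Fin (N + 1) ≃ Λ.Slot, c * ENNReal.ofReal (Λ.evB N) ≤ c * P (Λ.Ev a) := fun a =>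
    mul_le_mul' le_rfl (measure_Ev_ge (a := a) hW hσ hεσ hr)
  have hcardE : Fintype.card (Fin (N + 1) ≃ Λ.Slot) = (N + 1).factorial := by
    have e : Fin (N + 1) ≃ Λ.Slot := Fintype.equivOfCardEq (by rw [Fintype.card_fin, hcardN])
    rw [Fintype.card_equiv e, Fintype.card_fin]
  calc ENNReal.ofReal (((N + 1).factorial : ℝ) * Real.exp (Λ.Fmin N kw β 1) * Λ.evB N)
      = ((N + 1).factorial : ENNReal) * (c * ENNReal.ofReal (Λ.evB N)) := by
        rw [ENNReal.ofReal_mul (by positivity), ENNReal.ofReal_mul (by positivity), ENNReal.ofReal_natCast, hc,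
          mul_assoc]
    _ = ∑ _a : Fin (N + 1) ≃ Λ.Slot, c * ENNReal.ofReal (Λ.evB N) := by
        rw [Finset.sum_const, Finset.card_univ, hcardE, nsmul_eq_mul]
    _ ≤ ∑ a : Fin (N + 1) ≃ Λ.Slot, ∫⁻ z in Λ.Ev a, f z ∂P :=
        Finset.sum_le_sum fun a _ => (step3 a).trans (step2 a)
    _ ≤ _ := step1

end Lattice

/-! ## The concrete lattice: activity floor and the scale identity -/

section ConcreteFacts

variable {l n t : ℕ} (hl : 2 ≤ l) (ht : 24 * l ^ 2 ≤ t) (hn : 2 ≤ n)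
include hl ht hn

/-- On the witness lattice the energy floor is at least `(9/80) t⁶` (from the 13733 gain bound
`(9/50) c t⁶ ≤ gainT ≤ 2 ε gRec`, `ε = (4/5) c`). -/
theorem gRec_ge : (9 / 80 : ℝ) * (t : ℝ) ^ 6 ≤ gRec (LatW l n t).P := by
  have hn1 : 1 ≤ n := by omega
  have hc := LatW.c_pos (l := l) (n := n) hl hn1
  have hΛ := LatW.ok hl ht hn1
  have hG := LatW.gainOK hl ht hn1
  have h1 := LatW.gainT_ge hl ht hn
  have h2 := gainT_le hΛ hG
  have hε : (LatW l n t).P.ε = cscale l n * (4 / 5) := by rw [LatW.P_eq, Params.scale_ε, bpar.ε_eq]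
  rw [hε] at h2
  have h3 : (9 / 50) * cscale l n * (t : ℝ) ^ 6 ≤ 2 * (cscale l n * (4 / 5)) * gRec (LatW l n t).P := h1.trans h2
  have h4 : cscale l n * ((9 / 50) * (t : ℝ) ^ 6) ≤ cscale l n * ((8 / 5) * gRec (LatW l n t).P) := by
    have e1 : (9 / 50) * cscale l n * (t : ℝ) ^ 6 = cscale l n * ((9 / 50) * (t : ℝ) ^ 6) := by ring
    have e2 : 2 * (cscale l n * (4 / 5)) * gRec (LatW l n t).P = cscale l n * ((8 / 5) * gRec (LatW l n t).P) := by
      ring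
    rw [← e1, ← e2]; exact h3
  have h5 := le_of_mul_le_mul_left h4 hc
  linarith

omit hn in
/-- The scale identity `ε = (σ/τ) · w` on the witness lattice (`σ = (4/5)/l²`, `τ = t⁴`). -/
theorem ε_eq_κw : (LatW l n t).P.ε = (4 / 5) / (l : ℝ) ^ 2 / (t : ℝ) ^ 4 * (LatW l n t).w := by
  have hl0 : (0 : ℝ) < l := by exact_mod_cast (show 0 < l by omega)
  have hT := bpar.Tpos hl ht
  rw [LatW.P_eq, Params.scale_ε, bpar.ε_eq, LatW.w_eq]
  field_simp

end ConcreteFacts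

/-! ## The refutation of the strengthening -/

/-- **The exponential-moment strengthening of the equilibrium transfer-activity tails is false**, by the
frozen line-lattice Newton-cradle witness of the 13733 refutation: equilibrium data `a₀ = θ₀ = 1, u₀ = 0`,
`σ = (4/5)/l²`, `V = max V₀ 1`, `β = 2`, `ε = 1`, `τ = t⁴`, `N + 1 = (l n)³`; every receiving sphere of the
relay carries transfer activity `≥ (9/100) t²/l² > V`, so `2 Σᵢ aᵢ𝟙{aᵢ>V}` dominates the 13733 exponent at
`Z = 1` and the 13733 final inequality applies verbatim.  Under the crux's `L¹` currency the event is
invisible (weight `e^{−C(N+1) log(tl)}`): this kills the LD CURRENCY, not the crux. -/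
theorem transferActivityTailsExpMoment_false : ¬ TransferActivityTailsExpMoment := by
  classical
  intro H
  obtain ⟨σ₀, hσ₀, H⟩ := H 1 1 (0 : V3) one_pos one_pos
  -- the packing fraction `σ = (4/5)/l²`
  obtain ⟨l, hl, hlσ⟩ : ∃ l : ℕ, 2 ≤ l ∧ (4 / 5 : ℝ) / (l : ℝ) ^ 2 < σ₀ := by
    refine ⟨⌈1 / σ₀⌉₊ + 2, by omega, ?_⟩
    have h1 : 1 / σ₀ ≤ ⌈1 / σ₀⌉₊ := Nat.le_ceil _
    have hl2 : (1 / σ₀ : ℝ) + 2 ≤ ((⌈1 / σ₀⌉₊ + 2 : ℕ) : ℝ) := by push_cast; linarith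
    have hpos : 0 < 1 / σ₀ := by positivity
    set L : ℝ := ((⌈1 / σ₀⌉₊ + 2 : ℕ) : ℝ)
    have hL : 1 / σ₀ < L := by linarith
    have hL1 : 1 ≤ L := by linarith
    rw [div_lt_iff₀ (by positivity)]
    have : 1 < σ₀ * L := by rwa [div_lt_iff₀' hσ₀] at hL
    nlinarith
  set σ : ℝ := (4 / 5) / (l : ℝ) ^ 2 with hσdef
  have hl0 : (0 : ℝ) < l := by exact_mod_cast (show 0 < l by omega)
  have hl2 : (2 : ℝ) ≤ l := by exact_mod_cast hl
  have hσ : 0 < σ := by positivity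
  have hσ5 : σ ≤ 1 / 5 := by
    rw [hσdef, div_le_iff₀ (by positivity)]; nlinarith
  have hσ2 : σ < 1 / 2 := by linarith
  specialize H σ hσ hlσ (flowFam hσ hσ2)
  obtain ⟨V₀, hV₀, H⟩ := H
  specialize H (max V₀ 1) (le_max_left _ _) 2 two_pos 1 one_pos
  obtain ⟨τ₀, hτ₀, H⟩ := H
  -- the choice of `t` (`τ = t⁴`)
  obtain ⟨t, ht, hτt, hbig, htV⟩ : ∃ t : ℕ, 24 * l ^ 2 ≤ t ∧ τ₀ ≤ (t : ℝ) ^ 4 ∧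
      39 * (l : ℝ) ^ 2 * (224 + 6 * l + 40 * 1 * |(1 : ℝ) - 1|) ≤ 1 * t ∧ max V₀ 1 < t := by
    set X : ℝ := 39 * (l : ℝ) ^ 2 * (224 + 6 * l) with hX
    refine ⟨⌈τ₀⌉₊ + 24 * l ^ 2 + ⌈X⌉₊ + ⌈max V₀ 1⌉₊ + 1, by omega, ?_, ?_, ?_⟩
    · have h1 : τ₀ ≤ ⌈τ₀⌉₊ := Nat.le_ceil _
      have h2 : (⌈τ₀⌉₊ : ℝ) ≤ ((⌈τ₀⌉₊ + 24 * l ^ 2 + ⌈X⌉₊ + ⌈max V₀ 1⌉₊ + 1 : ℕ) : ℝ) := by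
        exact_mod_cast (by omega)
      have h3 : (1 : ℝ) ≤ ((⌈τ₀⌉₊ + 24 * l ^ 2 + ⌈X⌉₊ + ⌈max V₀ 1⌉₊ + 1 : ℕ) : ℝ) := by
        exact_mod_cast (by omega)
      calc τ₀ ≤ ((⌈τ₀⌉₊ + 24 * l ^ 2 + ⌈X⌉₊ + ⌈max V₀ 1⌉₊ + 1 : ℕ) : ℝ) := h1.trans h2
        _ = ((⌈τ₀⌉₊ + 24 * l ^ 2 + ⌈X⌉₊ + ⌈max V₀ 1⌉₊ + 1 : ℕ) : ℝ) ^ 1 := (pow_one _).symm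
        _ ≤ _ := pow_le_pow_right₀ h3 (by norm_num)
    · have h1 : X ≤ ⌈X⌉₊ := Nat.le_ceil _
      have h2 : (⌈X⌉₊ : ℝ) ≤ ((⌈τ₀⌉₊ + 24 * l ^ 2 + ⌈X⌉₊ + ⌈max V₀ 1⌉₊ + 1 : ℕ) : ℝ) := by
        exact_mod_cast (by omega)
      rw [sub_self, abs_zero, mul_zero, add_zero, one_mul]
      exact h1.trans h2
    · have h1 : max V₀ 1 ≤ ⌈max V₀ 1⌉₊ := Nat.le_ceil _
      have h2 : ((⌈max V₀ 1⌉₊ + 1 : ℕ) : ℝ) ≤ ((⌈τ₀⌉₊ + 24 * l ^ 2 + ⌈X⌉₊ + ⌈max V₀ 1⌉₊ + 1 : ℕ) : ℝ) := by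
        exact_mod_cast (by omega)
      push_cast at h2 ⊢
      linarith
  specialize H ((t : ℝ) ^ 4) hτt
  obtain ⟨N₀, H⟩ := H
  -- the choice of `n` and `N + 1 = (l n)³`
  set n : ℕ := N₀ + 18 * t ^ 7 * l ^ 2 + 10 with hn
  have hn2 : 2 ≤ n := by omega
  have hn1 : 1 ≤ n := by omega
  set N : ℕ := (l * n) ^ 3 - 1 with hNdef
  have hln : 1 ≤ l * n := Nat.mul_pos (by omega) (by omega)
  have hN : N + 1 = (l * n) ^ 3 := by
    have : 1 ≤ (l * n) ^ 3 := Nat.one_le_pow _ _ hln; omega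
  have hN₀ : N₀ ≤ N := by
    have h1 : l * n ≤ (l * n) ^ 3 := by
      calc l * n = (l * n) ^ 1 := (pow_one _).symm
        _ ≤ (l * n) ^ 3 := Nat.pow_le_pow_right hln (by norm_num)
    have h2 : n ≤ l * n := Nat.le_mul_of_pos_left n (by omega)
    omega
  have hE := H N hN₀
  -- the lattice
  set Λ := LatW' l n t with hΛ
  have hΛeq : Λ = LatW l n t := LatW'_eq hl hn1
  have hcard : Fintype.card Λ.Slot = N + 1 := by rw [hΛeq, LatW.card_slot, hN]
  have hchart : 4 * (6 * (t : ℝ) ^ 7 * (l : ℝ) ^ 2 + 4) ≤ (l : ℝ) ^ 3 * n := by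
    have hn' : ((18 * t ^ 7 * l ^ 2 + 10 : ℕ) : ℝ) ≤ n := by exact_mod_cast (by omega)
    push_cast at hn'
    have hl8 : (8 : ℝ) ≤ (l : ℝ) ^ 3 := by
      have := pow_le_pow_left₀ (by norm_num : (0:ℝ) ≤ 2) hl2 3; norm_num at this; exact this
    have h0 : (0 : ℝ) ≤ (t : ℝ) ^ 7 * (l : ℝ) ^ 2 := by positivity
    have h1 : (8 : ℝ) * n ≤ (l : ℝ) ^ 3 * n := mul_le_mul_of_nonneg_right hl8 (by positivity)
    nlinarith
  have hW : Λ.WinOK := by rw [hΛeq]; exact LatW.winOK hl ht hn1 hchart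
  have hG : Λ.GainOK := by rw [hΛeq]; exact LatW.gainOK hl ht hn1
  obtain ⟨hε12, hr12, -⟩ : Λ.P.ε < 1 / 2 ∧ Λ.P.r < 1 / 2 ∧ (4 / 5 : ℝ) / (l : ℝ) ^ 2 ≤ 1 / 2 := by
    rw [hΛeq]; exact LatW.small_facts hl ht hn1
  have hT := bpar.Tpos hl ht
  have hc := LatW.c_pos (l := l) (n := n) hl hn1
  have hw0 : 0 < Λ.w := by show 0 < cscale l n * ((t : ℝ) ^ 4 * (l : ℝ) ^ 2); positivity
  have hεσ : hsDiameter σ N = Λ.P.ε := rfl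
  have hgoodP : localGibbsMeasure σ (fun _ => 1) (fun _ => 0) (fun _ => (1 : ℝ)) N (flowFam hσ hσ2 N).goodᶜ = 0 :=
    localGibbsMeasure_absolutelyContinuous σ _ _ _ N (flowFam hσ hσ2 N) (flowFam hσ hσ2 N).measure_compl_good
  have hκ : 0 ≤ σ / (t : ℝ) ^ 4 := by positivity
  -- the activity floor beats the level
  have hVlt : max V₀ 1 < σ / (t : ℝ) ^ 4 * gRec Λ.P := by
    rw [hΛeq]
    have hg := gRec_ge (l := l) (n := n) (t := t) hl ht hn2
    have ht' : ((24 * l ^ 2 : ℕ) : ℝ) ≤ t := by exact_mod_cast ht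
    push_cast at ht'
    have h1 : σ / (t : ℝ) ^ 4 * ((9 / 80 : ℝ) * (t : ℝ) ^ 6) ≤ σ / (t : ℝ) ^ 4 * gRec (LatW l n t).P :=
      mul_le_mul_of_nonneg_left hg hκ
    have h2 : σ / (t : ℝ) ^ 4 * ((9 / 80 : ℝ) * (t : ℝ) ^ 6) = (9 / 100) * (t : ℝ) ^ 2 / (l : ℝ) ^ 2 := by
      rw [hσdef]; field_simp; ring
    have h3 : (t : ℝ) < (9 / 100) * (t : ℝ) ^ 2 / (l : ℝ) ^ 2 := by
      rw [lt_div_iff₀ (by positivity)]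
      nlinarith
    linarith
  have hκε : Λ.P.ε ≤ σ / (t : ℝ) ^ 4 * Λ.w := by
    rw [hΛeq, hσdef]; exact le_of_eq (ε_eq_κw (n := n) hl ht)
  obtain ⟨-, -, -, w4, w5, -⟩ := bpar.win_facts hl ht
  have hkK : 4 * t ^ 7 * l ^ 2 + 1 ≤ Λ.P.K := by rw [hΛeq]; exact w5
  have hkw : ((4 * t ^ 7 * l ^ 2 : ℕ) : ℝ) * Λ.P.θhi ≤ Λ.w := by
    rw [hΛeq, LatW.P_eq, Params.scale_θhi _ hc.ne', LatW.w_eq]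
    calc ((4 * t ^ 7 * l ^ 2 : ℕ) : ℝ) * (cscale l n * (bpar l t).θhi)
        = cscale l n * (((4 * t ^ 7 * l ^ 2 : ℕ) : ℝ) * (bpar l t).θhi) := by ring
      _ ≤ cscale l n * ((t : ℝ) ^ 4 * (l : ℝ) ^ 2) := mul_le_mul_of_nonneg_left w4 hc.le
  have hM : 24 * Λ.m ≤ Λ.M := by
    show 24 * (6 * t ^ 7 * l ^ 2 + 3) ≤ l ^ 3 * n
    have hl8 : 8 ≤ l ^ 3 := by
      calc 8 = 2 ^ 3 := by norm_num
        _ ≤ l ^ 3 := Nat.pow_le_pow_left hl 3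
    have hn' : 18 * t ^ 7 * l ^ 2 + 10 ≤ n := by omega
    calc 24 * (6 * t ^ 7 * l ^ 2 + 3) = 8 * (18 * t ^ 7 * l ^ 2 + 9) := by ring
      _ ≤ l ^ 3 * n := Nat.mul_le_mul hl8 (by omega)
  -- the main bound and the final inequality
  have key := lintegral_tail_ge (Λ := Λ) (Φ := flowFam hσ hσ2 N) hcard hW hG hε12 hr12 hw0 (by linarith) hεσ hgoodP
    (V := max V₀ 1) (β := 1) (B := 2) hκ hVlt zero_le_one (by norm_num) hκε hkK hkw hM
  have hfin := LatW.final_ineq hl ht hn2 hN one_pos 1 hbig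
  rw [← hΛeq] at hfin
  have hlt : ENNReal.ofReal (Real.exp (1 * ((N : ℝ) + 1))) <
      ENNReal.ofReal (((N + 1).factorial : ℝ) * Real.exp (Λ.Fmin N (4 * t ^ 7 * l ^ 2) 1 1) * Λ.evB N) := by
    rw [one_mul, ENNReal.ofReal_lt_ofReal_iff (lt_trans (Real.exp_pos _) hfin)]
    exact hfin
  -- identify the statement's integral with ours
  have hw : (t : ℝ) ^ 4 * ((N : ℝ) + 1) ^ (-(1 / 3 : ℝ)) = Λ.w := by
    rw [LatW.w_eq_stmt (t := t) hl hn1 hN, hΛeq]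
  rw [localGibbsLaw_eq, hw] at hE
  exact absurd (lt_of_lt_of_le hlt (key.trans hE)) (lt_irrefl _)

end TransferActivityTailsNegative

end Summit.AtomisticToContinuum.HydrodynamicLimit.Theorems

end
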